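import Mathlib.CategoryTheory.Monoidal.Cartesian.Mon
import Mathlib.LinearAlgebra.TensorProduct.Tower
import Mathlib.NumberTheory.Padics.PadicIntegers
import Mathlib.RepresentationTheory.Intertwining
import Literature.NumberTheory.DiophantineGeometry.AVGaloisModule
import HarnessLib

-- provenance: harness21/H21/H21/Prelude/ArithGeomL/AVIsogenyTate.lean @ 8c5dfde (interim HEAD d8f2665); M5 mechanical rewrite
/-!
# Homomorphisms, isogenies and Tate modules of abelian varieties (trunk ArithGeomL, C2)

For abelian varieties `A B : Literature.AbelianVariety K` over a field `K` (item G17) and a prime `ℓ`,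
this file sets up the interface behind the Tate conjecture for homomorphisms of abelian
varieties (Tate 1966 over finite fields, Faltings 1983 over number fields):

* `AbelianVariety.Hom.geomPointsMap f : A(K̄) →+ B(K̄)`, the map induced by `f : A ⟶ B` on
  geometric points (real: Mathlib `IsMonHom.monoidHom` made additive), with its
  `Γ_K`-equivariance `geomPointsMap_smul` and additivity in `f` (`geomPointsMap_add`, real, from
  Mathlib `MonObj.comp_mul`);
* `AbelianVariety.tateModuleMap f ℓ : T_ℓ A →ₗ[ℤ_ℓ] T_ℓ B` (item G16 `TateModule.map`), which is
  `Γ_K`-equivariant (`tateModuleMap_smul`);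
* `AbelianVariety.tateHom A B ℓ = Hom_{Γ_K}(T_ℓ A, T_ℓ B)`, which **is** Mathlib's
  `Representation.IntertwiningMap (A.tateRep ℓ) (B.tateRep ℓ)` (a `ℤ_[ℓ]`-module by Mathlib's
  instances), the additive map `homToTate A B ℓ : Hom(A, B) →+ Hom_{Γ_K}(T_ℓ A, T_ℓ B)` and its
  `ℤ_ℓ`-linear extension `faltingsTateMap A B ℓ : ℤ_ℓ ⊗_ℤ Hom(A, B) →ₗ[ℤ_ℓ] Hom_{Γ_K}(T_ℓ A, T_ℓ B)`
  (Mathlib `TensorProduct.AlgebraTensorModule.lift`);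
* the classical theorems, with sorried proofs and citations: `Hom(A, B)` is a finitely generated
  free abelian group of rank `≤ 4 dim A dim B` (Mumford §19 Thm. 3 and Cor. 1), injectivity of
  `faltingsTateMap` over any field (Mumford §19 Thm. 3), injectivity of `T_ℓ f` for an isogeny
  `f`, existence of a quasi-inverse of an isogeny (`IsIsogeny.exists_nsmul_inverse`), finite
  dimensionality of `End⁰(A)` and `V_ℓ A ≅ V_ℓ B` as `Γ_K`-representations for isogenous
  `A`, `B` (Mathlib `Representation.Equiv`).

The target statement **hodge.S27** (bijectivity of `faltingsTateMap` over number fields,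
semisimplicity) lives in `H21/Statements/Hodge/FaltingsAbelian.lean`, not here.

## Design notes

* A morphism `f : A ⟶ B` is an `InducedCategory` morphism; its underlying morphism of
  `K`-schemes is `f.hom.hom.hom : A.X ⟶ B.X` and carries Mathlib's `IsMonHom` instance, so
  `IsMonHom.monoidHom f.hom.hom.hom (specOver K K̄) : A(K̄) →* B(K̄)` is available and equals
  post-composition `AlgPoints.map f.hom.hom.hom` definitionally.
* No sorried lemma feeds a definition: `geomPointsMap_add`/`geomPointsMap_zero` (needed for the
  data `homToTate`, `faltingsTateMap`) have real proofs (G17 `hom_add` is `rfl`, then Mathlib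
  `MonObj.comp_mul` / `MonObj.comp_one`).
* `V_ℓ A ≅ V_ℓ B` for isogenous `A, B` is *not* given as data (its inverse would need a sorried
  bijectivity); we state `Nonempty ((A.rationalTateRep ℓ).Equiv (B.rationalTateRep ℓ))`.
* Mathlib searched: `IntertwiningMap`, `Representation.Equiv`, `IsMonHom.monoidHom`,
  `MonoidHom.toAdditive`, `AlgebraTensorModule.lift`, `LinearMap.toIntLinearMap` (all used); no
  abelian varieties / Tate modules / isogenies of abelian varieties in Mathlib.

## References

* D. Mumford, *Abelian Varieties*, §19, Theorem 3 (`Hom(X,Y) ⊗ ℤ_ℓ → Hom_{ℤ_ℓ}(T_ℓ X, T_ℓ Y)`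
  injective, `Hom(X,Y)` free of finite rank), Corollary 1 (`rank ≤ 4 dim X dim Y`), Corollary 2,
  and the Remark p. 169 (quasi-inverse of an isogeny).
* J. Tate, *Endomorphisms of abelian varieties over finite fields*, Invent. Math. 2 (1966),
  Main Theorem.
* G. Faltings, *Endlichkeitssätze für abelsche Varietäten über Zahlkörpern*, Invent. Math. 73
  (1983), Satz 3, Satz 4.
* J. S. Milne, *Abelian Varieties* (course notes), §§10, 12.
-/

universe u

open CategoryTheory AlgebraicGeometry MonoidalCategory
open scoped TensorProduct

noncomputable section

namespace Literature.NumberTheory.DiophantineGeometry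

section AbelianVariety
open Literature.AlgebraicGeometry.Motives (AbelianVariety)
open Literature.AlgebraicGeometry.Motives.AbelianVariety

open scoped MonObj

variable {K : Type u} [Field K] {A B C : AbelianVariety K}

/-! ### The map on geometric points induced by a homomorphism -/

section Hom
open Literature.AlgebraicGeometry.Motives.AbelianVariety.Hom

/-- The homomorphism `A(K̄) →+ B(K̄)` induced on geometric points by a morphism of abelian
varieties `f : A ⟶ B`, `P ↦ P ≫ f` (Mumford, *Abelian Varieties*, §4 and §19; Mathlib
`IsMonHom.monoidHom` for the monoid morphism `f.hom.hom.hom : A.X ⟶ B.X`, made additive by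
`MonoidHom.toAdditive`). [folklore] -/
def _root_.Literature.AlgebraicGeometry.Motives.AbelianVariety.Hom.geomPointsMap (f : A ⟶ B) : A.geomPoints →+ B.geomPoints :=
  MonoidHom.toAdditive
    (IsMonHom.monoidHom f.hom.hom.hom (Literature.AlgebraicGeometry.Motives.specOver K (AlgebraicClosure K)))

/-- Unfolding `geomPointsMap`: `toMul (geomPointsMap f P) = AlgPoints.map f (toMul P) = toMul P ≫ f`
(Mumford §4). [folklore] -/
theorem _root_.Literature.AlgebraicGeometry.Motives.AbelianVariety.Hom.geomPointsMap_apply (f : A ⟶ B) (P : A.geomPoints) :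
    Additive.toMul (geomPointsMap f P) =
      Literature.AlgebraicGeometry.Motives.AlgPoints.map f.hom.hom.hom (Additive.toMul P : A.Points (AlgebraicClosure K)) := rfl

/-- `geomPointsMap f` on a point written `ofMul P`, `P ∈ A(K̄)`:
`geomPointsMap f (ofMul P) = ofMul (P ≫ f)` (Mumford §4). [folklore] -/
@[simp]
theorem _root_.Literature.AlgebraicGeometry.Motives.AbelianVariety.Hom.geomPointsMap_ofMul (f : A ⟶ B) (P : A.Points (AlgebraicClosure K)) :
    geomPointsMap f (Additive.ofMul P) = Additive.ofMul (Literature.AlgebraicGeometry.Motives.AlgPoints.map f.hom.hom.hom P) := rfl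

/-- `geomPointsMap f` is `Γ_K`-equivariant: `f(σ • P) = σ • f(P)`, since `f` is defined over `K`
(Mumford §19, p. 176; Serre–Tate 1968, §1; from G17 `AlgPoints.map_smul`). [cite: SerreTate1968, §1] -/
@[simp]
theorem _root_.Literature.AlgebraicGeometry.Motives.AbelianVariety.Hom.geomPointsMap_smul (f : A ⟶ B) (σ : Field.absoluteGaloisGroup K) (P : A.geomPoints) :
    geomPointsMap f (σ • P) = σ • geomPointsMap f P := by
  apply Additive.toMul.injective
  rw [geomPointsMap_apply, AbelianVariety.toMul_smul, AbelianVariety.toMul_smul, geomPointsMap_apply,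
    Literature.AlgebraicGeometry.Motives.AlgPoints.absoluteGaloisGroup_smul_def, Literature.AlgebraicGeometry.Motives.AlgPoints.absoluteGaloisGroup_smul_def,
    Literature.AlgebraicGeometry.Motives.AlgPoints.map_apply, Literature.AlgebraicGeometry.Motives.AlgPoints.map_apply, Category.assoc]

/-- `geomPointsMap` of the identity is the identity (functoriality; Mumford §4). [folklore] -/
@[simp]
theorem _root_.Literature.AlgebraicGeometry.Motives.AbelianVariety.Hom.geomPointsMap_id (A : AbelianVariety K) :
    geomPointsMap (𝟙 A) = AddMonoidHom.id A.geomPoints := by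
  ext P
  apply Additive.toMul.injective
  rw [geomPointsMap_apply]
  exact Category.comp_id _

/-- `geomPointsMap` of a composite is the composite (functoriality; Mumford §4). [folklore] -/
theorem _root_.Literature.AlgebraicGeometry.Motives.AbelianVariety.Hom.geomPointsMap_comp (f : A ⟶ B) (g : B ⟶ C) :
    geomPointsMap (f ≫ g) = (geomPointsMap g).comp (geomPointsMap f) := by
  ext P
  apply Additive.toMul.injective
  rw [geomPointsMap_apply]
  exact (Category.assoc _ _ _).symm

/-- `geomPointsMap` is additive in `f`: `(f + g)(P) = f(P) + g(P)`, because addition of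
homomorphisms is pointwise (Mumford §19, first paragraph; G17 `hom_add` and Mathlib
`MonObj.comp_mul`). Real proof: this lemma feeds the data `homToTate`. [folklore] -/
theorem _root_.Literature.AlgebraicGeometry.Motives.AbelianVariety.Hom.geomPointsMap_add (f g : A ⟶ B) :
    geomPointsMap (f + g) = geomPointsMap f + geomPointsMap g := by
  ext P
  apply Additive.toMul.injective
  rw [geomPointsMap_apply, Literature.AlgebraicGeometry.Motives.AlgPoints.map_apply, hom_add, Grp.Hom.hom_mul, Mon.Hom.hom_mul,
    MonObj.comp_mul]
  rfl

/-- `geomPointsMap` of the zero homomorphism is zero (G17 `hom_zero`, Mathlib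
`MonObj.comp_one`). [folklore] -/
@[simp]
theorem _root_.Literature.AlgebraicGeometry.Motives.AbelianVariety.Hom.geomPointsMap_zero : geomPointsMap (0 : A ⟶ B) = 0 := by
  ext P
  apply Additive.toMul.injective
  rw [geomPointsMap_apply, Literature.AlgebraicGeometry.Motives.AlgPoints.map_apply, hom_zero, Grp.Hom.hom_one, Mon.Hom.hom_one,
    MonObj.comp_one]
  rfl

variable (A B) in
/-- `f ↦ geomPointsMap f` as an additive homomorphism `Hom(A, B) →+ Hom(A(K̄), B(K̄))`
(Mumford §19). [folklore] -/
def _root_.Literature.AlgebraicGeometry.Motives.AbelianVariety.Hom.geomPointsMapAddMonoidHom : (A ⟶ B) →+ (A.geomPoints →+ B.geomPoints) where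
  toFun := geomPointsMap
  map_zero' := geomPointsMap_zero
  map_add' := geomPointsMap_add

/-- `geomPointsMapAddMonoidHom A B f = geomPointsMap f`. [folklore] -/
@[simp]
theorem _root_.Literature.AlgebraicGeometry.Motives.AbelianVariety.Hom.geomPointsMapAddMonoidHom_apply (f : A ⟶ B) :
    geomPointsMapAddMonoidHom A B f = geomPointsMap f := rfl

end Hom

open Hom Literature.AlgebraicGeometry.Motives.AbelianVariety.Hom

/-! ### The induced map on Tate modules -/

section Tate

variable (ℓ : ℕ) [Fact ℓ.Prime]

/-- The `ℤ_ℓ`-linear map `T_ℓ f : T_ℓ A →ₗ[ℤ_ℓ] T_ℓ B` induced by `f : A ⟶ B` on Tate modules,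
`(a_n) ↦ (f a_n)` (Mumford §19, p. 176; item G16 `TateModule.map` applied to
`geomPointsMap f`). [folklore] -/
def _root_.Literature.AlgebraicGeometry.Motives.AbelianVariety.tateModuleMap (f : A ⟶ B) : A.tateModule ℓ →ₗ[ℤ_[ℓ]] B.tateModule ℓ :=
  EllipticCurves.TateModule.map ℓ (geomPointsMap f)

variable {ℓ}

/-- Components of `tateModuleMap`: `(T_ℓ f a)_n = f(a_n)` (Mumford §19). [folklore] -/
@[simp]
theorem _root_.Literature.AlgebraicGeometry.Motives.AbelianVariety.proj_tateModuleMap (f : A ⟶ B) (a : A.tateModule ℓ) (n : ℕ) :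
    EllipticCurves.TateModule.proj ℓ n (tateModuleMap ℓ f a) = geomPointsMap f (EllipticCurves.TateModule.proj ℓ n a) := rfl

variable (ℓ) in
/-- `T_ℓ` of the identity is the identity (functoriality; Mumford §19). [folklore] -/
@[simp]
theorem _root_.Literature.AlgebraicGeometry.Motives.AbelianVariety.tateModuleMap_id (A : AbelianVariety K) : tateModuleMap ℓ (𝟙 A) = LinearMap.id := by
  rw [tateModuleMap, geomPointsMap_id, EllipticCurves.TateModule.map_id]

variable (ℓ) in
/-- `T_ℓ` of a composite is the composite (functoriality; Mumford §19). [folklore] -/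
theorem _root_.Literature.AlgebraicGeometry.Motives.AbelianVariety.tateModuleMap_comp (f : A ⟶ B) (g : B ⟶ C) :
    tateModuleMap ℓ (f ≫ g) = (tateModuleMap ℓ g).comp (tateModuleMap ℓ f) := by
  rw [tateModuleMap, geomPointsMap_comp, EllipticCurves.TateModule.map_comp]; rfl

variable (ℓ) in
/-- `T_ℓ` is additive in `f`: `T_ℓ (f + g) = T_ℓ f + T_ℓ g` (Mumford §19; from
`geomPointsMap_add`). [folklore] -/
theorem _root_.Literature.AlgebraicGeometry.Motives.AbelianVariety.tateModuleMap_add (f g : A ⟶ B) :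
    tateModuleMap ℓ (f + g) = tateModuleMap ℓ f + tateModuleMap ℓ g := by
  ext a n
  simp [geomPointsMap_add]

variable (ℓ) in
/-- `T_ℓ 0 = 0` (Mumford §19; from `geomPointsMap_zero`). [folklore] -/
@[simp]
theorem _root_.Literature.AlgebraicGeometry.Motives.AbelianVariety.tateModuleMap_zero : tateModuleMap ℓ (0 : A ⟶ B) = 0 := by
  ext a n
  simp

/-- `T_ℓ f` is `Γ_K`-equivariant: `T_ℓ f (σ • a) = σ • T_ℓ f a` (Mumford §19, p. 176:
`Hom(A, B) → Hom_{ℤ_ℓ}(T_ℓ A, T_ℓ B)` lands in the `Γ_K`-invariants). Real proof from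
`geomPointsMap_smul`. [folklore] -/
theorem _root_.Literature.AlgebraicGeometry.Motives.AbelianVariety.tateModuleMap_smul (f : A ⟶ B) (σ : Field.absoluteGaloisGroup K) (a : A.tateModule ℓ) :
    tateModuleMap ℓ f (A.tateRep ℓ σ a) = B.tateRep ℓ σ (tateModuleMap ℓ f a) := by
  refine EllipticCurves.TateModule.ext fun n ↦ ?_
  simp [geomPointsMap_smul]

variable (A B ℓ)

/-- The `ℤ_ℓ`-module `Hom_{Γ_K}(T_ℓ A, T_ℓ B)` of `Γ_K`-equivariant `ℤ_ℓ`-linear maps between the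
Tate modules: Mathlib's `Representation.IntertwiningMap` of the Tate representations
(Mumford §19, Thm. 3; Tate 1966; Faltings 1983, Satz 4). An `abbrev`, so Mathlib's
`AddCommGroup` and `Module ℤ_[ℓ]` instances apply. [cite: Tate1966] -/
abbrev _root_.Literature.AlgebraicGeometry.Motives.AbelianVariety.tateHom : Type u := (A.tateRep ℓ).IntertwiningMap (B.tateRep ℓ)

variable {A B} in
/-- `T_ℓ f` as an element of `Hom_{Γ_K}(T_ℓ A, T_ℓ B)` (Mathlib
`LinearMap.intertwiningMap_of_isIntertwiningMap` with `tateModuleMap_smul`; Mumford §19). [folklore] -/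
def _root_.Literature.AlgebraicGeometry.Motives.AbelianVariety.tateIntertwiningMap (f : A ⟶ B) : tateHom A B ℓ :=
  (tateModuleMap ℓ f).intertwiningMap_of_isIntertwiningMap _ _ (tateModuleMap_smul f)

variable {A B} in
/-- The underlying linear map of `tateIntertwiningMap ℓ f` is `tateModuleMap ℓ f`. [folklore] -/
@[simp]
theorem _root_.Literature.AlgebraicGeometry.Motives.AbelianVariety.toLinearMap_tateIntertwiningMap (f : A ⟶ B) :
    (tateIntertwiningMap ℓ f).toLinearMap = tateModuleMap ℓ f := rfl

/-- The additive map `Hom(A, B) →+ Hom_{Γ_K}(T_ℓ A, T_ℓ B)`, `f ↦ T_ℓ f` (Mumford §19, Thm. 3;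
additivity from `tateModuleMap_add`). [folklore] -/
def _root_.Literature.AlgebraicGeometry.Motives.AbelianVariety.homToTate : (A ⟶ B) →+ tateHom A B ℓ where
  toFun := tateIntertwiningMap ℓ
  map_zero' := Representation.IntertwiningMap.ext (by simp)
  map_add' f g := Representation.IntertwiningMap.ext (by simp [tateModuleMap_add])

variable {A B} in
/-- `homToTate A B ℓ f = tateIntertwiningMap ℓ f`. [folklore] -/
@[simp]
theorem _root_.Literature.AlgebraicGeometry.Motives.AbelianVariety.homToTate_apply (f : A ⟶ B) : homToTate A B ℓ f = tateIntertwiningMap ℓ f := rfl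

variable {A B} in
/-- `homToTate A B ℓ f` acts on `T_ℓ A` as `tateModuleMap ℓ f`. [folklore] -/
theorem _root_.Literature.AlgebraicGeometry.Motives.AbelianVariety.homToTate_apply_apply (f : A ⟶ B) (a : A.tateModule ℓ) :
    homToTate A B ℓ f a = tateModuleMap ℓ f a := rfl

/-- The **Tate map** `ℤ_ℓ ⊗_ℤ Hom(A, B) →ₗ[ℤ_ℓ] Hom_{Γ_K}(T_ℓ A, T_ℓ B)`, `c ⊗ f ↦ c • T_ℓ f`, the
`ℤ_ℓ`-linear extension of `homToTate` (Mathlib `TensorProduct.AlgebraTensorModule.lift`). It is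
injective over any field (Mumford §19, Thm. 3) and bijective for `K` finite (Tate 1966) or a
number field (Faltings 1983, Satz 4). [cite: Tate1966] -/
def _root_.Literature.AlgebraicGeometry.Motives.AbelianVariety.faltingsTateMap : ℤ_[ℓ] ⊗[ℤ] (A ⟶ B) →ₗ[ℤ_[ℓ]] tateHom A B ℓ :=
  TensorProduct.AlgebraTensorModule.lift
    (((LinearMap.lsmul ℤ_[ℓ] (tateHom A B ℓ)).flip.restrictScalars ℤ ∘ₗ
      (homToTate A B ℓ).toIntLinearMap).flip)

variable {A B} in
/-- `faltingsTateMap` on pure tensors: `c ⊗ f ↦ c • T_ℓ f` (Mumford §19, Thm. 3). [folklore] -/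
@[simp]
theorem _root_.Literature.AlgebraicGeometry.Motives.AbelianVariety.faltingsTateMap_tmul (c : ℤ_[ℓ]) (f : A ⟶ B) :
    faltingsTateMap A B ℓ (c ⊗ₜ[ℤ] f) = c • homToTate A B ℓ f := rfl

end Tate

/-! ### Finiteness of `Hom(A, B)` and the theorems of Tate and Faltings (statements) -/

section Theorems

variable (A B)

/-- `Hom(A, B)` is a finitely generated abelian group (Mumford, *Abelian Varieties*, §19,
Theorem 3; Milne, *Abelian Varieties*, §10, Thm. 10.15). [cite: MumfordAV1970, §19 Thm. 3] -/
def _root_.Literature.AlgebraicGeometry.Motives.AbelianVariety.module_finite_hom : Prop :=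
  Module.Finite ℤ (A ⟶ B)

/-- `Hom(A, B)` is a free abelian group (torsion-free and finitely generated; Mumford §19,
Theorem 3 and its Corollary 1; Milne §10, Thm. 10.15). [cite: MumfordAV1970, §19 Thm. 3 and Cor. 1] -/
def _root_.Literature.AlgebraicGeometry.Motives.AbelianVariety.module_free_hom : Prop :=
  Module.Free ℤ (A ⟶ B)

/-- `rank_ℤ Hom(A, B) ≤ 4 · dim A · dim B` (Mumford §19, Corollary 1 of Theorem 3; Milne §10,
Thm. 10.15). [cite: MumfordAV1970, §19 Cor. 1 of Thm. 3] -/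
def _root_.Literature.AlgebraicGeometry.Motives.AbelianVariety.finrank_hom_le : Prop :=
  Module.finrank ℤ (A ⟶ B) ≤ 4 * A.dim * B.dim

/-- For `ℓ ≠ char K`, the Tate map `ℤ_ℓ ⊗ Hom(A, B) → Hom_{Γ_K}(T_ℓ A, T_ℓ B)` is injective, over
any field `K` (Mumford §19, Theorem 3; Milne §10, Thm. 10.15). [cite: MumfordAV1970, §19 Thm. 3] -/
def _root_.Literature.AlgebraicGeometry.Motives.AbelianVariety.faltingsTateMap_injective : Prop :=
  ∀ (ℓ : ℕ) [Fact ℓ.Prime] (hℓ : (ℓ : K) ≠ 0),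
    Function.Injective (faltingsTateMap A B ℓ)

variable {A B}

/-- An isogeny induces an injection `T_ℓ f : T_ℓ A ↪ T_ℓ B` for `ℓ ≠ char K` (its kernel is
finite, and `T_ℓ A` is torsion-free; Mumford §19, p. 172, `V_ℓ f` is an isomorphism; Milne §10). [cite: MumfordAV1970, §19 p. 172] -/
def _root_.Literature.AlgebraicGeometry.Motives.AbelianVariety.tateModuleMap_injective_of_isIsogeny : Prop :=
  ∀ {f : A ⟶ B} (hf : IsIsogeny f) (ℓ : ℕ) [Fact ℓ.Prime] (hℓ : (ℓ : K) ≠ 0),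
    Function.Injective (tateModuleMap ℓ f)

/-- An isogeny has a quasi-inverse: if `f : A → B` is an isogeny there are `g : B → A` and
`n > 0` with `g ∘ f = [n]_A` and `f ∘ g = [n]_B` (Mumford §19, Remark p. 169, with `n = deg f`;
Milne, *Abelian Varieties*, §8, 8.5). [cite: MumfordAV1970, §19 Remark p. 169] -/
def _root_.Literature.AlgebraicGeometry.Motives.AbelianVariety.IsIsogeny.exists_nsmul_inverse : Prop :=
  ∀ {f : A ⟶ B} (hf : IsIsogeny f),
    ∃ g : B ⟶ A, ∃ n : ℕ, 0 < n ∧ f ≫ g = n • 𝟙 A ∧ g ≫ f = n • 𝟙 B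

variable (A) in
/-- The endomorphism algebra `End⁰(A) = ℚ ⊗ End(A)` is a finite-dimensional `ℚ`-algebra
(of dimension `≤ 4 (dim A)²`; Mumford §19, Corollary 1 of Theorem 3, and Corollary 2). Spelled
with `Module.Finite` (Mathlib's `FiniteDimensional` is by definition `Module.Finite`; the
`FiniteDimensional` spelling does not elaborate on the type synonym `endAlgebra A`, whose
`Module ℚ` instance is only found through its `Algebra ℚ` instance). [cite: MumfordAV1970, §19 Cor. 1–2 of Thm. 3] -/
def _root_.Literature.AlgebraicGeometry.Motives.AbelianVariety.finiteDimensional_endAlgebra : Prop :=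
  Module.Finite ℚ (endAlgebra A)

/-- Isogenous abelian varieties have isomorphic rational Tate representations:
`V_ℓ A ≅ V_ℓ B` as `ℚ_ℓ[Γ_K]`-modules (an isogeny `f` has a quasi-inverse `g` with
`g f = [n]`, and `n` is invertible in `ℚ_ℓ`; Mumford §19, p. 172; Tate 1966, §1). Stated as
`Nonempty` of a Mathlib `Representation.Equiv`, not as data. [cite: Tate1966, §1] -/
def _root_.Literature.AlgebraicGeometry.Motives.AbelianVariety.nonempty_equiv_rationalTateRep_of_isIsogenous : Prop :=
  ∀ (h : IsIsogenous A B) (ℓ : ℕ) [Fact ℓ.Prime],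
    Nonempty ((A.rationalTateRep ℓ).Equiv (B.rationalTateRep ℓ))

end Theorems

end AbelianVariety

end Literature.NumberTheory.DiophantineGeometry
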